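import Mathlib
import HarnessLib
import Summits.HubbardSuperconductivity.HubbardSuperconductivity.Theorems.KLProgrammeKLRegimeEngineTowerLevLawOfRowsF

/-!
# Route `KLProgramme` — crux K3 ENGINE (stmt-HubbardSuperconductivity-20437 `KLRegimeEngineV17F2`), stub (b) v2, THE LEVELS PACKAGE (ℓ):
# THE FLOOR-KEYED RE-BASED LEVELLED LAW WITH THE AMPLITUDE ROWS DISCHARGED BY THE CHOICE OF `B` («(I5)-F», closed call)
# (cell gate-hubbard-kl, seat hubbard-kl-k3c3-p2 g15; `klTowerBLevF_le_law_lev_of_doors` (…TowerLevLawOfRowsF) ∘ `towerLevNumericsG_amp_of_le_B` (…TowerLevNumericsG))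

The two AMPLITUDE rows of `klTowerBLevF_le_law_lev_of_doors` (`8·Φ·τ·Y ≤ 1`, `128·e·ψ³·τ⁴·Φ·κ·Y ≤ (1 − r)·ρ³`) hold as soon as the data entering `Y` are
B-DISCOUNTED — base amplitude `A_b = Â_b/B²` (the grid-shaped base read through `λ = B·ε ≥ B·Klam·|U|`, …TowerLevBaseDisc), four-leg import `ι₂ = ῑ₂/B`,
six-leg cell `X = X̄/B²` (the natural scalings of bounds stated against `λ = B·ε`) — and `B ≥ B₀ := max 1 (max (8Φτ·Ȳ) (128·e·ψ³τ⁴Φ·κ·Ȳ/((1 − r)ρ³)))` with the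
B-free `Ȳ = ῑ₂/(2Q′) + W·Z³·X̄/(4Q′²) + (W·27⁵·Â_b + κ·Â_b)·Q′/2` (`towerLevNumericsG_amp_of_le_B`).

* **`klTowerBLevF_le_law_lev_of_doors_of_le_B`** — the floor-keyed law at `λ := B·epsCoupling P U j` in the KL regime with, as NUMERICAL hypotheses, only the
  BLOCKING row `max 1 Z · C₂² · max 4 (2τψ) ≤ 2^{d−1}` (choice of `d`: `towerLevNumericsG_exists_blocking`), `B ≥ B₀`, and the two doors (U-door, c-door);
  the structural inputs are unchanged: base datum `N_b` with its (discounted) unit law, imports `ι₁`, `ῑ₂/B`, cell `X̄/B²`, and the floor LINK `hstep`.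
Composition of landed theorems; nothing about the model is asserted beyond them and the named inputs; nothing asserts (ℓ), any stub, K3 or superconductivity.
References: BGM 2006 §2.8 (2.83), (2.93)–(2.98), Lemma 2.5 [cite: BenfattoGiulianiMastropietro2006].
-/

noncomputable section

namespace Summit.HubbardSuperconductivity.HubbardSuperconductivity.Theorems.EngineV8

set_option linter.dupNamespace false -- summit = problem name (single-conjunct summit), D-0017

open Classical
open Real Finset Literature.MathematicalPhysics.QuantumLattice Literature.Probability.LatticeModels GrassmannAlgebra
open Literature.MathematicalPhysics.QuantumLattice.FermiRG
open Summit.HubbardSuperconductivity.HubbardSuperconductivity.Theorems.KLProgrammeLegKernels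
open Summit.HubbardSuperconductivity.HubbardSuperconductivity.Theorems.KLRegimeSplit
open Summit.HubbardSuperconductivity.HubbardSuperconductivity.Theorems.KLRegimeWick
open Summit.HubbardSuperconductivity.HubbardSuperconductivity.Theorems.TorusFourierL2
open Summit.HubbardSuperconductivity.HubbardSuperconductivity.Theorems.DispersionFlow

/-- **THE FLOOR-KEYED RE-BASED LEVELLED TOWER LAW, DOORS FORM, AMPLITUDES BY `B ≥ B₀`** (see the module docstring; equational binders = the explicit (I5)-F choices
and the B-discounted data `A_b′ = Â_b/B²`, `ι₂′ = ῑ₂/B`, `X′ = X̄/B²`; `rfl` at the call). [cite: BenfattoGiulianiMastropietro2006, §2.8 (2.83), (2.93)-(2.98)] -/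
theorem klTowerBLevF_le_law_lev_of_doors_of_le_B :
    ∃ C₁ C₂ : ℝ, 0 < C₁ ∧ 0 < C₂ ∧ ∀ R : RenConsts, R.WF2 → ∃ c₃' : ℝ, 0 < c₃' ∧ ∃ U₀' : ℝ, 0 < U₀' ∧
      ∀ (P : SplitConsts) (c : ℝ), P.WF → 0 < c → c ≤ klEngC₃6 P R → c ≤ c₃' →
      ∀ μ ∈ klWindowC, ∀ U : ℝ, 0 < U → U ≤ klEngU₀9 P R c → U ≤ U₀' → ∀ β : ℝ, klBetaMin ≤ β → β ≤ Real.exp (c / U ^ 2) →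
      ∀ K : TrigPolyC4v, FrameOK R U (nScales β) μ K → ∀ (L M : ℕ) [NeZero L] [NeZero M],
      klEngL₃ β U ≤ L → klEngM₃ β U L ≤ M → ∀ d Kb D : ℕ, 2 ≤ d → d * Kb - 1 ≤ nScales β + 1 → 3 ≤ D →
      ∀ (cc : ℝ) (n j : ℕ), IsKLRegime U cc (-(n : ℤ)) → j ≤ n →
      ∀ (B Ab Qb ι₂ X : ℝ), 1 ≤ B → 0 < Ab → 0 ≤ Qb → 0 ≤ ι₂ → 0 ≤ X →
      -- the B-discounted data (equational binders)
      ∀ (Ab' ι₂' X' : ℝ), Ab' = Ab / B ^ 2 → ι₂' = ι₂ / B → X' = X / B ^ 2 →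
      -- the base datum at the family `F_{d−1}` and its unit law in the discounted shape, at `λ = B·ε_j`
      ∀ Nb : Fin 5 → ℕ → ℝ, (∀ t p, 0 ≤ Nb t p) →
        (∀ (t : Fin 5) (p : ℕ) (Ωe' : Fin (2 * p) → Option (SectorLeg (sectorCount (d - 1)))), levelCount Ωe' = (t : ℕ) + 1 →
          klLevNormOf L M β μ K (d - 1) (2 * p) (klTowerInput L M β U μ K d 1) Ωe' ≤ Nb t p) →
        (∀ (t : Fin 5) (p : ℕ), 3 ≤ p → Nb t p / klLevUnitF β M t p (d - 1) ≤ Ab' * (B * epsCoupling P U j) ^ (p - 1) * Qb ^ p) →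
      ∀ (W Z σ Φ ψ τ ι₁ : ℝ), 0 < W → 0 < Z → 0 ≤ σ → 0 ≤ Φ → 0 ≤ ψ → 0 < τ → 0 ≤ ι₁ →
      -- the explicit (I5)-F choices (equational binders) and the B-free `Ȳ`
      ∀ (ρ Q' Q κ Yb Y A A' ι₃ : ℝ), ρ = max 4 (2 * τ * ψ) → Q' = Z * Qb + 1 → Q = ρ * Q' →
        κ = W * ((27 : ℝ) ^ 5 * (C₁ / C₂) * (8 : ℝ) ^ (d - 1)) →
        Yb = ι₂ / (2 * Q') + W * Z ^ 3 * X / (4 * Q' ^ 2) + (W * (27 : ℝ) ^ 5 * Ab + κ * Ab) * Q' / 2 →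
        Y = ι₂' / (2 * Q') + W * Z ^ 3 * X' / (4 * Q' ^ 2) + (W * (27 : ℝ) ^ 5 * Ab' + κ * Ab') * Q' / 2 →
        A = 2 * Y * (1 - ((2 : ℝ) ^ d)⁻¹) / (κ * Q') →
        A' = (W * (27 : ℝ) ^ 5 * Ab' + κ * Ab') + 2 * Y / Q' → ι₃ = W * Z ^ 3 * X' + A' * Q' ^ 3 →
      -- the BLOCKING row (choice of `d`) and `B ≥ B₀` (the two amplitude rows)
      max 1 Z * C₂ ^ 2 * max 4 (2 * τ * ψ) ≤ (2 : ℝ) ^ (d - 1) →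
      max 1 (max (8 * Φ * τ * Yb) (128 * exp 1 * ψ ^ 3 * τ ^ 4 * Φ * κ * Yb / ((1 - ((2 : ℝ) ^ d)⁻¹) * ρ ^ 3))) ≤ B →
      -- the imports (E1 (I4)) and the located cell, in the discounted shapes, at `λ = B·ε_j`
      (∀ k, 1 ≤ k → k < Kb → W * Z ^ 1 * klTowerMuLevF L M β U μ K d k 1 ≤ ι₁ * (B * epsCoupling P U j)) →
      (∀ k, 1 ≤ k → k < Kb → W * Z ^ 2 * klTowerMuLevF L M β U μ K d k 2 ≤ ι₂' * (B * epsCoupling P U j)) →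
      (∀ k, 2 ≤ k → k < Kb → klTowerMuLevAtF L M β U μ K d 0 k 3 ≤ X' * (B * epsCoupling P U j) ^ 2) →
      -- the floor step at blocks `k ≥ 1` (the «(I1)-LEV-FLOOR» LINK)
      (∀ t : Fin 5, ∀ k, 1 ≤ k → k < Kb → ∀ N : ℕ, 2 ≤ N → ∀ p, 3 ≤ p → p ≤ D →
        Φ * towerV D τ (fun m => W * Z ^ m * klTowerMuLevF L M β U μ K d k m) < 1 →
        klTowerBLevF L M β U μ K d t (k + 1) p ≤
          towerFO D σ (fun m => W * Z ^ m * klTowerMuLevF L M β U μ K d k m) p +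
            ∑ n ∈ Icc 2 N, exp 1 * Φ ^ (n - 1) * ψ ^ p * towerS D τ (fun m => W * Z ^ m * klTowerMuLevF L M β U μ K d k m) n p +
            ψ ^ p * exp 1 * towerV D τ (fun m => W * Z ^ m * klTowerMuLevF L M β U μ K d k m) *
              (Φ * towerV D τ (fun m => W * Z ^ m * klTowerMuLevF L M β U μ K d k m)) ^ N /
              (1 - Φ * towerV D τ (fun m => W * Z ^ m * klTowerMuLevF L M β U μ K d k m))) →
      -- the two doors
      U ≤ min 1 (min (1 / (8 * σ * Q' + 1)) (min (1 / (2 * exp 1 * τ * Q' + 1)) (min (1 / (4 * Φ * τ * ι₁ + 1))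
        (min (1 / (2 * (Φ * (exp 1 * τ * ι₁ + (exp 1 * τ) ^ 2 * ι₂' + (exp 1 * τ) ^ 3 * ι₃ + A' * (exp 1 * τ * Q') ^ 2 / 2)) + 1))
          (min (A * Q ^ 3 / (16 * σ * Q' * A' * (4 * Q') ^ 3 + A * Q ^ 3))
            (A * Q ^ 3 / (16 * exp 1 * ψ * (2 * τ * ψ * Q') ^ 2 * Φ * τ ^ 2 * ι₁ ^ 2 + A * Q ^ 3))))))) / (2 * B * P.Klam + 1) →
      cc ≤ min 1 (min (1 / (8 * σ * Q' + 1)) (min (1 / (2 * exp 1 * τ * Q' + 1)) (min (1 / (4 * Φ * τ * ι₁ + 1))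
        (min (1 / (2 * (Φ * (exp 1 * τ * ι₁ + (exp 1 * τ) ^ 2 * ι₂' + (exp 1 * τ) ^ 3 * ι₃ + A' * (exp 1 * τ * Q') ^ 2 / 2)) + 1))
          (min (A * Q ^ 3 / (16 * σ * Q' * A' * (4 * Q') ^ 3 + A * Q ^ 3))
            (A * Q ^ 3 / (16 * exp 1 * ψ * (2 * τ * ψ * Q') ^ 2 * Φ * τ ^ 2 * ι₁ ^ 2 + A * Q ^ 3))))))) * Real.log 4 / (2 * B * P.Klam + 1) →
      ∀ k, 2 ≤ k → k ≤ Kb → ∀ (t : Fin 5) (p : ℕ), 3 ≤ p → p ≤ D →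
        klTowerBLevF L M β U μ K d t k p ≤ A * (B * epsCoupling P U j) ^ (p - 1) * Q ^ p := by
  obtain ⟨C₁, C₂, hC₁, hC₂, h⟩ := klTowerBLevF_le_law_lev_of_doors
  refine ⟨C₁, C₂, hC₁, hC₂, fun R hR2 => ?_⟩
  obtain ⟨c₃, hc₃, U₀, hU₀, h'⟩ := h R hR2
  refine ⟨c₃, hc₃, U₀, hU₀, ?_⟩
  intro P c hP hc hc6 hc₃' μ hμ U hU hU9 hU₀' β hβmin hβc K hK L M _ _ hL3 hM3 d Kb D hd hKbN hD cc n j hreg hj B Ab Qb ι₂ X hB hAb hQb hι₂ hX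
    Ab' ι₂' X' hAb' hι₂' hX' Nb hNb0 hcar hlawb W Z σ Φ ψ τ ι₁ hW hZ hσ hΦ hψ hτ hι₁ ρ Q' Q κ Yb Y A A' ι₃ hρ hQ' hQ hκ hYb hY hA hA' hι₃
    hblock hBle himp₁ himp₂ hcell hstep hUdoor hcdoor
  have hB0 : 0 < B := lt_of_lt_of_le one_pos hB
  have hAb'0 : 0 < Ab' := by rw [hAb']; positivity
  have hι₂'0 : 0 ≤ ι₂' := by rw [hι₂']; positivity
  have hX'0 : 0 ≤ X' := by rw [hX']; positivity
  -- the two amplitude rows from `B ≥ B₀`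
  have hκ0 : 0 ≤ κ := by rw [hκ]; positivity
  have hr1 : ((2 : ℝ) ^ d)⁻¹ < 1 := inv_lt_one_of_one_lt₀ (one_lt_pow₀ (by norm_num) (by omega))
  have hρ0 : 0 < ρ := by rw [hρ]; exact lt_of_lt_of_le (by norm_num) (le_max_left _ _)
  have hQ'0 : 0 < Q' := by rw [hQ']; positivity
  have ha₁ : W * (27 : ℝ) ^ 5 * Ab' = W * (27 : ℝ) ^ 5 * Ab / B ^ 2 := by rw [hAb']; ring
  obtain ⟨amp1, amp2⟩ := towerLevNumericsG_amp_of_le_B (κA := κ) (r := ((2 : ℝ) ^ d)⁻¹) (a := W * (27 : ℝ) ^ 5 * Ab' + κ * Ab')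
    (ab := W * (27 : ℝ) ^ 5 * Ab + κ * Ab) hΦ hψ hτ hW hZ hκ0 hr1 hρ0 hι₂ hX (by positivity : 0 ≤ W * (27 : ℝ) ^ 5 * Ab) hAb.le hQ'0
    hι₂' hX' ha₁ hAb' rfl rfl hY hYb hBle
  exact h' P c hP hc hc6 hc₃' μ hμ U hU hU9 hU₀' β hβmin hβc K hK L M hL3 hM3 d Kb D hd hKbN hD cc n j hreg hj B Ab' Qb hB0 hAb'0 hQb Nb hNb0 hcar hlawb
    W Z σ Φ ψ τ ι₁ ι₂' X' hW hZ hσ hΦ hψ hτ hι₁ hι₂'0 hX'0 ρ Q' Q κ Y A A' ι₃ hρ hQ' hQ hκ hY hA hA' hι₃ hblock amp1 amp2 himp₁ himp₂ hcell hstep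
    hUdoor hcdoor

end Summit.HubbardSuperconductivity.HubbardSuperconductivity.Theorems.EngineV8
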